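import Literature.Barriers.ABC.NoArithmeticDerivativeSmallDerivCore
import HarnessLib

/-!
# Small arithmetic derivatives from abc — the cube pigeonhole (Pasten 2021, towards Cor. 4.6)

`Literature/Barriers/ABC/NoArithmeticDerivativeSmallDerivCube.lean` — second of three companion
files discharging `Literature.Barriers.ABC.Pasten.smallDerivatives_of_abcQualityForm`
[cite: Pasten2021, Cor. 4.6 with Thm. 4.5] (the discharge is in
`Literature.Barriers.ABC.NoArithmeticDerivativeSmallDerivProofs`; the bookkeeping in
`Literature.Barriers.ABC.NoArithmeticDerivativeSmallDerivCore`).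

Pasten produces small `ψ ∈ 𝒯(a,b)` with `a, b` `ψ`-independent from a full basis of `𝒯(a,b)`
given by the Bombieri–Vaaler Siegel lemma (Minkowski's second theorem; Thm. 2.5/2.6) and, under
abc, the lower bound of Lemma 4.4 for bases of the degenerate lattice `𝒯°(a,b)`. Neither
Minkowski II nor Bombieri–Vaaler is in Mathlib, so this formalisation uses instead an elementary
**cube pigeonhole with escape** which needs only the basic pigeonhole principle:

* `exists_nondegenerate_of_card_lt` (abstract): if an additive `f : ℤ^ι → ℤ` takes `≤ #T` values
  on the cube `[0,H]^ι`, its largest fibre has `> #cube/#T` points; if all differences of points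
  of that fibre lay in a "degenerate" set whose bounded elements vanish on `K`, are divisible by
  `m_i` on `R` and are determined by their `K ∪ R` coordinates, the fibre would inject into a box
  of size `∏_{R} (H/m_i + 1)` — so a large cube forces a NON-degenerate `y` with `f y = 0`,
  `‖y‖∞ ≤ H`;
* `exists_of_cube` (Case B for an abc triple): with `f = linF` (the additivity defect (EqnAdd)),
  degenerate = `𝒯°` (EqnDepDep), `K` = good primes `> H` (killed by Pasten's divisibility
  `p ∣ v_p(abc) ψ(ξ_p)`, proof of Lemma 4.4), pivots `q₁, q₂` in different members, and moduli
  `m_p = p` on the other good primes, the count reduces to the MASTER INEQUALITY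
  `(2·coefSum + 1) · 2^{ω(abc)} · c · q₁q₂ · badProd < (H+1)² · rad(abc)`,
  which abc (`rad(abc) ≫ c^{1−ε}`) supplies for `H ≈ c^{7/8}`, `q₁ q₂ ≤ 2√c`
  (`NoArithmeticDerivativeSmallDerivProofs`).
-/

open Finset

namespace Literature.Barriers.ABC.Pasten

open Literature.NumberTheory.DiophantineGeometry

section Abstract

variable {ι : Type*} [Fintype ι] [DecidableEq ι]

/-- **Cube pigeonhole with escape from a degenerate sublattice** (abstract form). Let `f` be an
additive integer-valued function on `ℤ^ι` taking values in `T` on the cube `[0, H]^ι`, and `Deg`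
a property of vectors ("degenerate") such that every degenerate `y` with `‖y‖∞ ≤ H` vanishes on
`K`, has `m_i ∣ y_i` on `R`, and is determined by its `K ∪ R` coordinates. If
`#T · ∏_{i ∈ R} (H/m_i + 1) < (H+1)^{#ι}`, some `y` with `f y = 0`, `‖y‖∞ ≤ H` is NOT degenerate:
the largest fibre of `f` on the cube has more than `∏ (H/m_i + 1)` points, but if all pairwise
differences in it were degenerate it would inject (by floor division of the `R`-coordinates) into
a box of that size. [folklore] -/
theorem exists_nondegenerate_of_card_lt
    (f : (ι → ℤ) → ℤ) (hf : ∀ x y, f (x - y) = f x - f y)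
    (Deg : (ι → ℤ) → Prop)
    (H : ℕ) (K R : Finset ι) (m : ι → ℕ)
    (hK : ∀ y, Deg y → (∀ i, |y i| ≤ H) → ∀ i ∈ K, y i = 0)
    (hR : ∀ y, Deg y → ∀ i ∈ R, (m i : ℤ) ∣ y i)
    (hdet : ∀ y, Deg y → (∀ i ∈ K, y i = 0) → (∀ i ∈ R, y i = 0) → y = 0)
    (T : Finset ℤ) (hT : ∀ x : ι → ℤ, (∀ i, 0 ≤ x i ∧ x i ≤ H) → f x ∈ T)
    (hcount : #T * ∏ i ∈ R, (H / m i + 1) < (H + 1) ^ Fintype.card ι) :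
    ∃ y : ι → ℤ, f y = 0 ∧ ¬ Deg y ∧ ∀ i, |y i| ≤ H := by
  classical
  by_contra hneg
  push Not at hneg
  set cube : Finset (ι → ℤ) := Fintype.piFinset fun _ : ι => Finset.Icc (0 : ℤ) H with hcube
  have hcube_card : #cube = (H + 1) ^ Fintype.card ι := by
    rw [hcube, Fintype.card_piFinset, Finset.prod_const, Int.card_Icc, Finset.card_univ]
    congr 1
  have hmem_cube : ∀ x ∈ cube, ∀ i, 0 ≤ x i ∧ x i ≤ H := by
    intro x hx i
    have := (Fintype.mem_piFinset.mp hx) i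
    simpa using this
  have hmaps : ∀ x ∈ cube, f x ∈ T := fun x hx => hT x (hmem_cube x hx)
  rw [← hcube_card] at hcount
  obtain ⟨v, -, hv⟩ := Finset.exists_lt_card_fiber_of_mul_lt_card_of_maps_to hmaps hcount
  set S' : Finset (ι → ℤ) := {x ∈ cube | f x = v} with hS'
  have hS'cube : ∀ x ∈ S', x ∈ cube := fun x hx => (Finset.mem_filter.mp hx).1
  have hdeg : ∀ x ∈ S', ∀ x' ∈ S', Deg (x - x') ∧ (∀ i, |(x - x') i| ≤ H) := by
    intro x hx x' hx'
    rw [hS', Finset.mem_filter] at hx hx'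
    have habs : ∀ i, |(x - x') i| ≤ H := by
      intro i
      have h1 := hmem_cube x hx.1 i
      have h2 := hmem_cube x' hx'.1 i
      simp only [Pi.sub_apply]
      rw [abs_le]
      constructor <;> linarith
    refine ⟨?_, habs⟩
    by_contra hnd
    obtain ⟨i, hi⟩ := hneg (x - x') (by rw [hf, hx.2, hx'.2, sub_self]) hnd
    exact absurd (habs i) (not_le.mpr hi)
  let g : (ι → ℤ) → ι → ℕ := fun x i => if i ∈ R then (x i).toNat / m i else 0
  let B : Finset (ι → ℕ) :=
    Fintype.piFinset fun i => if i ∈ R then Finset.range (H / m i + 1) else {0}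
  have hB_card : #B = ∏ i ∈ R, (H / m i + 1) := by
    simp only [B, Fintype.card_piFinset]
    rw [← Finset.prod_filter_mul_prod_filter_not Finset.univ (· ∈ R)]
    have h1 : ∏ i ∈ Finset.univ.filter (· ∈ R),
        #(if i ∈ R then Finset.range (H / m i + 1) else {0}) = ∏ i ∈ R, (H / m i + 1) := by
      have : Finset.univ.filter (· ∈ R) = R := by ext i; simp
      rw [this]
      refine Finset.prod_congr rfl fun i hi => ?_
      rw [if_pos hi, Finset.card_range]
    have h2 : ∏ i ∈ Finset.univ.filter (fun i => ¬ i ∈ R),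
        #(if i ∈ R then Finset.range (H / m i + 1) else {0}) = 1 := by
      refine Finset.prod_eq_one fun i hi => ?_
      rw [Finset.mem_filter] at hi
      rw [if_neg hi.2, Finset.card_singleton]
    rw [h1, h2, mul_one]
  have hg_maps : ∀ x ∈ S', g x ∈ B := by
    intro x hx
    rw [Fintype.mem_piFinset]
    intro i
    by_cases hi : i ∈ R
    · simp only [g, if_pos hi, Finset.mem_range]
      have h := hmem_cube x (hS'cube x hx) i
      have hxi : (x i).toNat ≤ H := by
        have : x i ≤ (H : ℤ) := h.2
        omega
      exact Nat.lt_succ_of_le (Nat.div_le_div_right hxi)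
    · simp [g, hi]
  have hg_inj : Set.InjOn g S' := by
    intro x hx x' hx' hgx
    obtain ⟨hD, habs⟩ := hdeg x hx x' hx'
    have hKeq : ∀ i ∈ K, (x - x') i = 0 := hK _ hD habs
    have hReq : ∀ i ∈ R, (x - x') i = 0 := by
      intro i hi
      have hdiv : (m i : ℤ) ∣ x i - x' i := hR _ hD i hi
      have hq : (x i).toNat / m i = (x' i).toNat / m i := by
        have := congrFun hgx i
        simpa [g, hi] using this
      have h0 := (hmem_cube x (hS'cube x hx) i).1
      have h0' := (hmem_cube x' (hS'cube x' hx') i).1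
      have hx_eq : x i = ((x i).toNat : ℤ) := (Int.toNat_of_nonneg h0).symm
      have hx'_eq : x' i = ((x' i).toNat : ℤ) := (Int.toNat_of_nonneg h0').symm
      rw [hx_eq, hx'_eq] at hdiv
      have hmod : (x' i).toNat ≡ (x i).toNat [MOD m i] := Nat.modEq_iff_dvd.mpr hdiv
      have hu : m i * ((x i).toNat / m i) + (x i).toNat % m i = (x i).toNat := Nat.div_add_mod _ _
      have hu' : m i * ((x' i).toNat / m i) + (x' i).toNat % m i = (x' i).toNat :=
        Nat.div_add_mod _ _
      have : (x i).toNat = (x' i).toNat := by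
        rw [← hu, ← hu', hq, show (x i).toNat % m i = (x' i).toNat % m i from hmod.symm]
      simp only [Pi.sub_apply]
      rw [hx_eq, hx'_eq, this, sub_self]
    exact sub_eq_zero.mp (hdet _ hD hKeq hReq)
  have hcard : #S' ≤ #B := Finset.card_le_card_of_injOn g hg_maps hg_inj
  rw [hB_card] at hcard
  exact absurd hv (not_lt.mpr hcard)

end Abstract

/-! ### Case B: the cube pigeonhole for an abc triple -/

variable {a b c : ℕ}

/-- **Case B (cube pigeonhole for an abc triple).** Let `(a,b,c)` be an abc triple, `H` a height
with `H + 1 ≤ c`, and `q₁, q₂ ≤ H` two primes of `abc` lying in different members. Assume that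
at most one "good" prime of `abc` (`p ∤ v_p(abc)`) exceeds `H`, and the master inequality
`(2·coefSum + 1) · 2^{ω(abc)} · c · q₁q₂ · badProd < (H+1)² · rad(abc)`.
Then there is `ψ` supported on the primes of `abc` with `linF ψ = 0` (i.e. `ψ ∈ 𝒯(a,b)`),
`ψ` not degenerate (i.e. `a, b` are `ψ`-independent) and `‖ψ‖ ≤ H`.
Proof: `exists_nondegenerate_of_card_lt` with `K` = good primes `> H` (killed by
`Degenerate.dvd_factorization`), pivots `q₁, q₂` (`Degenerate.eq_zero_of_support_pair`), moduli
`m_p = p` on the remaining good primes; the counting reduces to the master inequality.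
This replaces Pasten's appeal to the Bombieri–Vaaler Siegel lemma (Thm. 2.5/2.6) and Lemma 4.4.
[folklore] -/
theorem exists_of_cube (h : IsABCTriple a b c) (H : ℕ) {q₁ q₂ : ℕ}
    (hq₁ : q₁ ∈ (a * b * c).primeFactors) (hq₂ : q₂ ∈ (a * b * c).primeFactors)
    (hsep : SepPair a b c q₁ q₂) (hq₁H : q₁ ≤ H) (hq₂H : q₂ ≤ H) (hHc : H + 1 ≤ c)
    (hK1 : ∀ p ∈ (a * b * c).primeFactors, ∀ p' ∈ (a * b * c).primeFactors,
      ¬ p ∣ (a * b * c).factorization p → ¬ p' ∣ (a * b * c).factorization p' →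
      H < p → H < p' → p = p')
    (hM : (2 * coefSum a b c + 1) * 2 ^ #(a * b * c).primeFactors * c * (q₁ * q₂) * badProd a b c
      < (H + 1) ^ 2 * radOf (a * b * c)) :
    ∃ ψ : ℕ → ℤ, (∀ q, q ∉ (a * b * c).primeFactors → ψ q = 0) ∧ linF a b c ψ = 0 ∧
      ¬ Degenerate a b c ψ ∧ ∀ q, |ψ q| ≤ H := by
  classical
  -- notation
  set J := (a * b * c).primeFactors with hJdef
  set kk : ℕ → ℕ := fun p => (a * b * c).factorization p with hkk
  let good : ℕ → Prop := fun p => ¬ p ∣ kk p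
  have hc0 : 0 < c := lt_of_lt_of_le (Nat.succ_pos H) hHc
  have hne : q₁ ≠ q₂ := hsep.ne h hq₁
  -- the data of the abstract lemma
  let f : (J → ℤ) → ℤ := fun x => linF a b c (extJ a b c x)
  let Deg : (J → ℤ) → Prop := fun x => Degenerate a b c (extJ a b c x)
  let K : Finset J := Finset.univ.filter fun i => good i.1 ∧ H < i.1
  let R : Finset J := Finset.univ.filter fun i => ¬ (good i.1 ∧ H < i.1) ∧ i.1 ≠ q₁ ∧ i.1 ≠ q₂
  let m : J → ℕ := fun i => if good i.1 then i.1 else 1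
  let T : Finset ℤ := Finset.Icc (-(H * coefSum a b c : ℤ)) (H * coefSum a b c)
  -- structural hypotheses
  have hf : ∀ x y, f (x - y) = f x - f y := fun x y => by
    simp only [f]
    rw [extJ_sub, linF_sub]
  have hprime : ∀ i : J, Nat.Prime i.1 := fun i => Nat.prime_of_mem_primeFactors i.2
  have hgood_dvd : ∀ y : J → ℤ, Deg y → ∀ i : J, good i.1 → (i.1 : ℤ) ∣ y i := by
    intro y hD i hg
    have hd := Degenerate.dvd_factorization h hD i.2
    rw [extJ_apply_mem i.2] at hd
    rcases (Nat.prime_iff_prime_int.mp (hprime i)).dvd_or_dvd hd with hd | hd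
    · exact absurd (by exact_mod_cast hd) hg
    · exact hd
  have hK : ∀ y, Deg y → (∀ i, |y i| ≤ H) → ∀ i ∈ K, y i = 0 := by
    intro y hD hyH i hi
    obtain ⟨hg, hHi⟩ := (Finset.mem_filter.mp hi).2
    refine Int.eq_zero_of_abs_lt_dvd (hgood_dvd y hD i hg) ?_
    exact lt_of_le_of_lt (hyH i) (by exact_mod_cast hHi)
  have hR : ∀ y, Deg y → ∀ i ∈ R, (m i : ℤ) ∣ y i := by
    intro y hD i _
    by_cases hg : good i.1
    · simp only [m, if_pos hg]; exact hgood_dvd y hD i hg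
    · simp only [m, if_neg hg]; simp
  have hdet : ∀ y, Deg y → (∀ i ∈ K, y i = 0) → (∀ i ∈ R, y i = 0) → y = 0 := by
    intro y hD hyK hyR
    have hsupp : ∀ p ∈ (a * b * c).primeFactors, p ≠ q₁ → p ≠ q₂ → extJ a b c y p = 0 := by
      intro p hp h1 h2
      rw [extJ_apply_mem hp]
      by_cases hk : good p ∧ H < p
      · exact hyK ⟨p, hp⟩ (Finset.mem_filter.mpr ⟨Finset.mem_univ _, hk⟩)
      · exact hyR ⟨p, hp⟩ (Finset.mem_filter.mpr ⟨Finset.mem_univ _, hk, h1, h2⟩)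
    have hall := Degenerate.eq_zero_of_support_pair h hD hq₁ hq₂ hsep hsupp
    funext i
    have := hall i.1 i.2
    rwa [extJ_apply_mem i.2] at this
  have hT : ∀ x : J → ℤ, (∀ i, 0 ≤ x i ∧ x i ≤ H) → f x ∈ T := by
    intro x hx
    have hψ : ∀ p ∈ (a * b * c).primeFactors, 0 ≤ extJ a b c x p ∧ extJ a b c x p ≤ H := by
      intro p hp
      rw [extJ_apply_mem hp]
      exact hx ⟨p, hp⟩
    have := abs_linF_le (a := a) (b := b) (c := c) hψ
    simp only [T, f, Finset.mem_Icc]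
    exact abs_le.mp this
  -- the count
  have hcount : #T * ∏ i ∈ R, (H / m i + 1) < (H + 1) ^ Fintype.card J := by
    -- pivots and the partition `univ = R ⊔ (K ⊔ Piv)`
    let Piv : Finset J := {⟨q₁, hq₁⟩, ⟨q₂, hq₂⟩}
    have hPiv_mem : ∀ i : J, i ∈ Piv ↔ (i.1 = q₁ ∨ i.1 = q₂) := by
      intro i
      simp only [Piv, Finset.mem_insert, Finset.mem_singleton, Subtype.ext_iff]
    have hPiv_card : #Piv = 2 := by
      refine Finset.card_pair fun heq => hne ?_
      exact congrArg Subtype.val heq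
    have hPiv_prod : ∏ i ∈ Piv, (i.1 : ℕ) = q₁ * q₂ := by
      rw [Finset.prod_pair fun heq => hne (congrArg Subtype.val heq)]
    have hRgood : ∀ i ∈ R, good i.1 → i.1 ≤ H := by
      intro i hi hg
      have := (Finset.mem_filter.mp hi).2.1
      by_contra hlt
      exact this ⟨hg, not_le.mp hlt⟩
    have hKPiv : Disjoint K Piv := by
      rw [Finset.disjoint_left]
      intro i hiK hiP
      have hHi := (Finset.mem_filter.mp hiK).2.2
      rcases (hPiv_mem i).mp hiP with h1 | h1
      · exact absurd (h1 ▸ hHi) (not_lt.mpr hq₁H)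
      · exact absurd (h1 ▸ hHi) (not_lt.mpr hq₂H)
    have hRc : Finset.univ.filter (fun i : J => ¬ (¬ (good i.1 ∧ H < i.1) ∧ i.1 ≠ q₁ ∧ i.1 ≠ q₂))
        = K ∪ Piv := by
      ext i
      simp only [Finset.mem_filter, Finset.mem_univ, true_and, Finset.mem_union, hPiv_mem, K]
      tauto
    have hN : Fintype.card J = #R + (#K + 2) := by
      rw [← hPiv_card, ← Finset.card_union_of_disjoint hKPiv, ← hRc]
      simp only [R]
      rw [Finset.card_filter_add_card_filter_not, Finset.card_univ]
    have hKle : #K ≤ 1 := by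
      refine Finset.card_le_one.mpr fun i hi j hj => ?_
      obtain ⟨hgi, hHi⟩ := (Finset.mem_filter.mp hi).2
      obtain ⟨hgj, hHj⟩ := (Finset.mem_filter.mp hj).2
      exact Subtype.ext (hK1 i.1 i.2 j.1 j.2 hgi hgj hHi hHj)
    -- the product `X` of the good `R`-primes and the bound `P · X ≤ (2(H+1))^{#R}`
    let X : ℕ := ∏ i ∈ R, (if good i.1 then i.1 else 1)
    have hX_pos : 0 < X := Finset.prod_pos fun i _ => by
      split_ifs
      · exact (hprime i).pos
      · exact Nat.one_pos
    have hPX : (∏ i ∈ R, (H / m i + 1)) * X ≤ (2 * (H + 1)) ^ #R := by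
      rw [← Finset.prod_mul_distrib, ← Finset.prod_const]
      refine Finset.prod_le_prod' fun i hi => ?_
      by_cases hg : good i.1
      · simp only [m, if_pos hg]
        have h1 : H / i.1 * i.1 ≤ H := Nat.div_mul_le_self H i.1
        have h2 : i.1 ≤ H := hRgood i hi hg
        nlinarith
      · simp only [m, if_neg hg, Nat.div_one, mul_one]
        omega
    -- `#T ≤ (H+1)(2·coefSum+1)`
    have hTcard : #T ≤ (H + 1) * (2 * coefSum a b c + 1) := by
      have : #T = 2 * H * coefSum a b c + 1 := by
        simp only [T, Int.card_Icc]
        have e : (H : ℤ) * coefSum a b c + 1 - -((H : ℤ) * coefSum a b c) =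
            ((2 * H * coefSum a b c + 1 : ℕ) : ℤ) := by push_cast; ring
        rw [e, Int.toNat_natCast]
      rw [this]
      nlinarith
    -- `rad(abc) ≤ X · badProd · c^{#K} · q₁ q₂`
    have hval_le : ∀ i : J, i.1 ≤ c := fun i =>
      (Nat.le_of_mem_primeFactors (mem_primeFactors_memberOf h i.2).1).trans
        (mem_primeFactors_memberOf h i.2).2.1
    have hrad : radOf (a * b * c) ≤ X * badProd a b c * c ^ #K * (q₁ * q₂) := by
      have e1 : radOf (a * b * c) = ∏ i ∈ (Finset.univ : Finset J), (i.1 : ℕ) := by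
        unfold radOf
        exact (Finset.prod_coe_sort J (fun p => p)).symm
      have e2 : ∏ i ∈ (Finset.univ : Finset J), (i.1 : ℕ) =
          (∏ i ∈ R, (i.1 : ℕ)) * ∏ i ∈ K ∪ Piv, (i.1 : ℕ) := by
        rw [← hRc]
        exact (Finset.prod_filter_mul_prod_filter_not _ _ _).symm
      have e3 : ∏ i ∈ R, (i.1 : ℕ) = X * ∏ i ∈ R with ¬ good i.1, (i.1 : ℕ) := by
        rw [← Finset.prod_filter_mul_prod_filter_not R (fun i => good i.1)]
        congr 1
        rw [Finset.prod_filter]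
      have e4 : ∏ i ∈ R with ¬ good i.1, (i.1 : ℕ) ≤ badProd a b c := by
        have eb : badProd a b c = ∏ i ∈ (Finset.univ : Finset J) with ¬ good i.1, (i.1 : ℕ) := by
          unfold badProd
          rw [Finset.prod_filter, Finset.prod_filter, ← Finset.prod_coe_sort J]
          refine Finset.prod_congr rfl fun i _ => ?_
          simp only [good, not_not, kk]
        rw [eb]
        refine Finset.prod_le_prod_of_subset_of_one_le' (fun i hi => ?_) (fun i _ _ => (hprime i).pos)
        exact Finset.mem_filter.mpr ⟨Finset.mem_univ _, (Finset.mem_filter.mp hi).2⟩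
      have e5 : ∏ i ∈ K ∪ Piv, (i.1 : ℕ) ≤ c ^ #K * (q₁ * q₂) := by
        rw [Finset.prod_union hKPiv, hPiv_prod]
        exact Nat.mul_le_mul_right _ (Finset.prod_le_pow_card K _ c fun i _ => hval_le i)
      rw [e1, e2, e3]
      calc X * (∏ i ∈ R with ¬ good i.1, (i.1 : ℕ)) * ∏ i ∈ K ∪ Piv, (i.1 : ℕ)
          ≤ X * badProd a b c * (c ^ #K * (q₁ * q₂)) :=
            Nat.mul_le_mul (Nat.mul_le_mul_left _ e4) e5
        _ = X * badProd a b c * c ^ #K * (q₁ * q₂) := by ring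
    -- the key inequality `(2·coefSum+1) · 2^{#R} < (H+1)^{#K+1} · X`
    have hpow : 2 ^ #R ≤ 2 ^ #J := by
      refine Nat.pow_le_pow_right (by norm_num) ?_
      rw [← Fintype.card_coe J, hN]; omega
    have hkey : (2 * coefSum a b c + 1) * 2 ^ #R < (H + 1) ^ (#K + 1) * X := by
      have hM' : (2 * coefSum a b c + 1) * 2 ^ #J * c * (q₁ * q₂) * badProd a b c <
          (H + 1) ^ 2 * (X * badProd a b c * c ^ #K * (q₁ * q₂)) :=
        lt_of_lt_of_le hM (Nat.mul_le_mul_left _ hrad)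
      have hq : 0 < q₁ * q₂ := Nat.mul_pos (hprime ⟨q₁, hq₁⟩).pos (hprime ⟨q₂, hq₂⟩).pos
      have hbad : 0 < badProd a b c :=
        Finset.prod_pos fun p hp => (Nat.prime_of_mem_primeFactors (Finset.mem_filter.mp hp).1).pos
      interval_cases hKc : #K
      · -- no good prime above `H`
        simp only [pow_zero, mul_one, zero_add, pow_one] at hM' ⊢
        have h1 : (2 * coefSum a b c + 1) * 2 ^ #J * c * (q₁ * q₂) * badProd a b c <
            (H + 1) * X * c * (q₁ * q₂) * badProd a b c := by
          calc _ < (H + 1) ^ 2 * (X * badProd a b c * (q₁ * q₂)) := hM'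
            _ = (H + 1) * (H + 1) * X * (q₁ * q₂) * badProd a b c := by ring
            _ ≤ (H + 1) * c * X * (q₁ * q₂) * badProd a b c := by gcongr
            _ = (H + 1) * X * c * (q₁ * q₂) * badProd a b c := by ring
        have h2 : (2 * coefSum a b c + 1) * 2 ^ #J < (H + 1) * X :=
          Nat.lt_of_mul_lt_mul_right (Nat.lt_of_mul_lt_mul_right (Nat.lt_of_mul_lt_mul_right h1))
        calc (2 * coefSum a b c + 1) * 2 ^ #R ≤ (2 * coefSum a b c + 1) * 2 ^ #J :=
              Nat.mul_le_mul_left _ hpow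
          _ < (H + 1) * X := h2
      · simp only [pow_one] at hM'
        have h1 : (2 * coefSum a b c + 1) * 2 ^ #J * c * (q₁ * q₂) * badProd a b c <
            (H + 1) ^ 2 * X * c * (q₁ * q₂) * badProd a b c := by
          calc _ < (H + 1) ^ 2 * (X * badProd a b c * c * (q₁ * q₂)) := hM'
            _ = (H + 1) ^ 2 * X * c * (q₁ * q₂) * badProd a b c := by ring
        have h2 : (2 * coefSum a b c + 1) * 2 ^ #J < (H + 1) ^ 2 * X :=
          Nat.lt_of_mul_lt_mul_right (Nat.lt_of_mul_lt_mul_right (Nat.lt_of_mul_lt_mul_right h1))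
        calc (2 * coefSum a b c + 1) * 2 ^ #R ≤ (2 * coefSum a b c + 1) * 2 ^ #J :=
              Nat.mul_le_mul_left _ hpow
          _ < (H + 1) ^ (1 + 1) * X := h2
    -- assemble
    rw [hN]
    refine Nat.lt_of_mul_lt_mul_right (a := X) ?_
    calc #T * (∏ i ∈ R, (H / m i + 1)) * X
        = #T * ((∏ i ∈ R, (H / m i + 1)) * X) := by ring
      _ ≤ (H + 1) * (2 * coefSum a b c + 1) * (2 * (H + 1)) ^ #R := Nat.mul_le_mul hTcard hPX
      _ = (H + 1) ^ (#R + 1) * ((2 * coefSum a b c + 1) * 2 ^ #R) := by rw [mul_pow]; ring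
      _ < (H + 1) ^ (#R + 1) * ((H + 1) ^ (#K + 1) * X) :=
          Nat.mul_lt_mul_of_pos_left hkey (by positivity)
      _ = (H + 1) ^ (#R + (#K + 2)) * X := by ring
  obtain ⟨y, hy0, hynd, hyH⟩ :=
    exists_nondegenerate_of_card_lt f hf Deg H K R m hK hR hdet T hT hcount
  refine ⟨extJ a b c y, fun q hq => extJ_apply_not_mem hq, hy0, hynd, fun q => ?_⟩
  by_cases hq : q ∈ (a * b * c).primeFactors
  · rw [extJ_apply_mem hq]; exact hyH ⟨q, hq⟩
  · rw [extJ_apply_not_mem hq, abs_zero]; positivity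

end Literature.Barriers.ABC.Pasten
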